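import Summits.QuantumFields.YangMills.Theorems.BalabanLadderIRcofSchurFejerTwistChar
import HarnessLib

/-!
# Schur–Fejér splitting — §6 (6c–6d): ISOTYPIC amplitudes ∕ projections ∕ characters of `ρH↾⟨k₀⟩` and the isotypic SCHUR MONOMIAL

Ideator `ym-ir-idea-22` g4 · crux `IRcof` (stmt-QuantumFields-26930) · row 47 stub S2ᵛ; source `Cruxes/IRcof/Lines/equipartition_seam_SchurFejerCore.lean`
rev 8 (c954a4ca1dd2d859) §6 «arbitrary faithful `ρH`: twist characters, the isotypic Schur monomial, generation», extracted VERBATIM by the custody LEAD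
ym-ir-line-ab-p1 g7 (LEAD LANE PROTOCOL (b); critic ym-ir-crit-3 g4 «LAND-ASK #4 WORD = GO» 22:06:44Z, K1‴–K4‴).  The 400-line cap forces THREE files
(`…SchurFejerTwistChar` = 6a–6b + algebra, `…SchurFejerIsotypic` = isotypic amplitudes ∕ projections ∕ characters + the Schur monomial,
`…SchurFejerCyclicKer` = generation + ★ `splitVanishingAt_of_cyclic_ker`); this file: `isoAmp ∕ isoProj ∕ isoChar` (Fourier components of `j ↦ ρH (k₀^j)`: commuting PSD projections, `isoChar` = normalised isotypic traces), `isTwistChar_isoChar` (each isotypic character is a twist character for `(k₀, ω^j)`), `isTwistChar_isoMonomial` (Schur monomials of isotypic characters are twist characters).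
Same namespace `…EquipartitionSeam.SchurFejer` (no wholesale `open` downstream).  Gate-forced only: one-line docstrings where the lint requires them
(and `private` on a tree-duplicate if the dedup gate names one).  HONEST: the located lemma S2ᵛ of one registered line, proved on the cyclic-kernel sub-class;
walls S3 ∕ S5ᵛ untouched; width 0; YM mass gap (Clay) NOT proved; `IRcof` 0∕1; R4 = `BalabanLadder.UV` only.
-/

set_option autoImplicit false

noncomputable section

open Finset Complex

namespace Summit.QuantumFields.YangMills.Cruxes.IRcof.EquipartitionSeam.SchurFejer

open scoped ComplexOrder Matrix

section Iso

open Literature.MathematicalPhysics.QuantumFieldTheory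
open Summit.QuantumFields.YangMills.Theorems.NonSimplyConnectedLatticeGap (latticeRep_map_inv)

variable {H : Type} [Group H] [TopologicalSpace H]

/-- The isotypic AMPLITUDE `A_j = Σ_{m<N} ((ω^j)⁻¹)^m ρH(k₀^m)` (`N ·` the spectral projector of `ρH k₀` at `ω^j`). -/
def isoAmp (ρH : LatticeRep H) (k₀ : H) (ω : ℂ) (N j : ℕ) : Matrix (Fin ρH.N) (Fin ρH.N) ℂ :=
  ∑ m ∈ range N, ((ω ^ j)⁻¹) ^ m • ρH.ρ (k₀ ^ m)

/-- `P_j := A_jᴴ A_j` — positive semidefinite, central when `k₀` is. -/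
def isoProj (ρH : LatticeRep H) (k₀ : H) (ω : ℂ) (N j : ℕ) : Matrix (Fin ρH.N) (Fin ρH.N) ℂ :=
  (isoAmp ρH k₀ ω N j)ᴴ * isoAmp ρH k₀ ω N j

/-- The isotypic normalised character `u_j(h) = tr(P_j ρH h) / tr P_j`. -/
def isoChar (ρH : LatticeRep H) (k₀ : H) (ω : ℂ) (N j : ℕ) (h : H) : ℂ :=
  (isoProj ρH k₀ ω N j * ρH.ρ h).trace / (isoProj ρH k₀ ω N j).trace

/-- `latticeRep_comm_of_mem_center` (see the module docstring; verbatim from the Lines core §6). -/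
lemma latticeRep_comm_of_mem_center (ρH : LatticeRep H) {k : H} (hk : k ∈ Subgroup.center H)
    (h : H) : ρH.ρ k * ρH.ρ h = ρH.ρ h * ρH.ρ k := by
  rw [← map_mul, ← map_mul, (Subgroup.mem_center_iff.1 hk h)]

/-- `A_j` commutes with `ρH(H)` (`k₀` central). -/
theorem isoAmp_comm (ρH : LatticeRep H) {k₀ : H} (hc : k₀ ∈ Subgroup.center H) (ω : ℂ) (N j : ℕ)
    (h : H) : isoAmp ρH k₀ ω N j * ρH.ρ h = ρH.ρ h * isoAmp ρH k₀ ω N j := by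
  unfold isoAmp
  rw [Finset.sum_mul, Finset.mul_sum]
  refine Finset.sum_congr rfl fun m _ => ?_
  rw [Matrix.smul_mul, Matrix.mul_smul, latticeRep_comm_of_mem_center ρH (Subgroup.pow_mem _ hc m)]

/-- `A_jᴴ` commutes with `ρH(H)`. -/
theorem isoAmp_conjTranspose_comm (ρH : LatticeRep H) {k₀ : H} (hc : k₀ ∈ Subgroup.center H)
    (ω : ℂ) (N j : ℕ) (h : H) :
    (isoAmp ρH k₀ ω N j)ᴴ * ρH.ρ h = ρH.ρ h * (isoAmp ρH k₀ ω N j)ᴴ := by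
  have e := congrArg Matrix.conjTranspose (isoAmp_comm ρH hc ω N j h⁻¹)
  rw [Matrix.conjTranspose_mul, Matrix.conjTranspose_mul, ← latticeRep_map_inv, inv_inv] at e
  exact e.symm

/-- `P_j` commutes with `ρH(H)`. -/
theorem isoProj_comm (ρH : LatticeRep H) {k₀ : H} (hc : k₀ ∈ Subgroup.center H) (ω : ℂ) (N j : ℕ)
    (h : H) : isoProj ρH k₀ ω N j * ρH.ρ h = ρH.ρ h * isoProj ρH k₀ ω N j := by
  unfold isoProj
  rw [Matrix.mul_assoc, isoAmp_comm ρH hc, ← Matrix.mul_assoc, isoAmp_conjTranspose_comm ρH hc,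
    Matrix.mul_assoc]

/-- EIGEN-RELATION `ρH(k₀) A_j = ω^j A_j` (cyclic shift of the sum; `k₀^N = 1`, `ω^N = 1`). -/
theorem rho_mul_isoAmp (ρH : LatticeRep H) {k₀ : H} {N : ℕ} (hN : orderOf k₀ = N) {ω : ℂ}
    (hωN : ω ^ N = 1) (hω0 : ω ≠ 0) (j : ℕ) :
    ρH.ρ k₀ * isoAmp ρH k₀ ω N j = ω ^ j • isoAmp ρH k₀ ω N j := by
  set c : ℂ := (ω ^ j)⁻¹ with hcdef
  have hc0 : c ≠ 0 := inv_ne_zero (pow_ne_zero _ hω0)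
  have hcN : c ^ N = 1 := by
    rw [hcdef, inv_pow, ← pow_mul, mul_comm, pow_mul, hωN, one_pow, inv_one]
  have hkN : k₀ ^ N = 1 := by rw [← hN]; exact pow_orderOf_eq_one k₀
  set f : ℕ → Matrix (Fin ρH.N) (Fin ρH.N) ℂ := fun m => c ^ m • ρH.ρ (k₀ ^ m) with hf
  have hA : isoAmp ρH k₀ ω N j = ∑ m ∈ range N, f m := rfl
  have h1 : ρH.ρ k₀ * isoAmp ρH k₀ ω N j = ∑ m ∈ range N, c ^ m • ρH.ρ (k₀ ^ (m + 1)) := by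
    rw [hA, Finset.mul_sum]
    refine Finset.sum_congr rfl fun m _ => ?_
    rw [hf, Matrix.mul_smul, ← map_mul, ← pow_succ']
  have h2 : c • (ρH.ρ k₀ * isoAmp ρH k₀ ω N j) = isoAmp ρH k₀ ω N j := by
    rw [h1, Finset.smul_sum]
    have h3 : ∑ m ∈ range N, c • (c ^ m • ρH.ρ (k₀ ^ (m + 1))) = ∑ m ∈ range N, f (m + 1) :=
      Finset.sum_congr rfl fun m _ => by rw [hf, smul_smul, ← pow_succ']
    rw [h3, eq_sub_of_add_eq (Finset.sum_range_succ' f N).symm, Finset.sum_range_succ, hA]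
    have hfN : f N = 1 := by
      show c ^ N • ρH.ρ (k₀ ^ N) = 1
      rw [hcN, hkN, map_one, one_smul]
    have hf0 : f 0 = 1 := by
      show c ^ 0 • ρH.ρ (k₀ ^ 0) = 1
      rw [pow_zero, pow_zero, map_one, one_smul]
    rw [hfN, hf0, add_sub_cancel_right]
  calc ρH.ρ k₀ * isoAmp ρH k₀ ω N j = c⁻¹ • c • (ρH.ρ k₀ * isoAmp ρH k₀ ω N j) :=
        (inv_smul_smul₀ hc0 _).symm
    _ = ω ^ j • isoAmp ρH k₀ ω N j := by rw [h2, hcdef, inv_inv]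

/-- `P_j ρH(k₀) = ω^j P_j`. -/
theorem isoProj_mul_rho (ρH : LatticeRep H) {k₀ : H} (hc : k₀ ∈ Subgroup.center H) {N : ℕ}
    (hN : orderOf k₀ = N) {ω : ℂ} (hωN : ω ^ N = 1) (hω0 : ω ≠ 0) (j : ℕ) :
    isoProj ρH k₀ ω N j * ρH.ρ k₀ = ω ^ j • isoProj ρH k₀ ω N j := by
  unfold isoProj
  rw [Matrix.mul_assoc, isoAmp_comm ρH hc, rho_mul_isoAmp ρH hN hωN hω0, Matrix.mul_smul]

/-- `posSemidef_isoProj` (see the module docstring; verbatim from the Lines core §6). -/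
theorem posSemidef_isoProj (ρH : LatticeRep H) (k₀ : H) (ω : ℂ) (N j : ℕ) :
    (isoProj ρH k₀ ω N j).PosSemidef :=
  Matrix.posSemidef_conjTranspose_mul_self _

/-- `isoProj_conjTranspose` (see the module docstring; verbatim from the Lines core §6). -/
theorem isoProj_conjTranspose (ρH : LatticeRep H) (k₀ : H) (ω : ℂ) (N j : ℕ) :
    (isoProj ρH k₀ ω N j)ᴴ = isoProj ρH k₀ ω N j :=
  (posSemidef_isoProj ρH k₀ ω N j).isHermitian

/-- `tr P_j` is real and non-negative: `tr P_j = ((tr P_j).re : ℂ)` with `0 ≤ (tr P_j).re`. -/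
theorem isoProj_trace_eq_re (ρH : LatticeRep H) (k₀ : H) (ω : ℂ) (N j : ℕ) :
    (isoProj ρH k₀ ω N j).trace = (((isoProj ρH k₀ ω N j).trace.re : ℝ) : ℂ) ∧
      0 ≤ (isoProj ρH k₀ ω N j).trace.re := by
  have h := (posSemidef_isoProj ρH k₀ ω N j).trace_nonneg
  rw [Complex.nonneg_iff] at h
  refine ⟨Complex.ext (by simp) (by simp [h.2]), h.1⟩

/-- `star_isoProj_trace` (see the module docstring; verbatim from the Lines core §6). -/
theorem star_isoProj_trace (ρH : LatticeRep H) (k₀ : H) (ω : ℂ) (N j : ℕ) :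
    starRingEnd ℂ (isoProj ρH k₀ ω N j).trace = (isoProj ρH k₀ ω N j).trace := by
  rw [(isoProj_trace_eq_re ρH k₀ ω N j).1, Complex.conj_ofReal]

/-- TWIST: `u_j(k₀ h) = ω^j u_j(h)`. -/
theorem isoChar_twist (ρH : LatticeRep H) {k₀ : H} (hc : k₀ ∈ Subgroup.center H) {N : ℕ}
    (hN : orderOf k₀ = N) {ω : ℂ} (hωN : ω ^ N = 1) (hω0 : ω ≠ 0) (j : ℕ) (h : H) :
    isoChar ρH k₀ ω N j (k₀ * h) = ω ^ j * isoChar ρH k₀ ω N j h := by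
  unfold isoChar
  rw [map_mul, ← Matrix.mul_assoc, isoProj_mul_rho ρH hc hN hωN hω0, Matrix.smul_mul,
    Matrix.trace_smul, smul_eq_mul, mul_div_assoc]

/-- `isoChar_one` (see the module docstring; verbatim from the Lines core §6). -/
theorem isoChar_one (ρH : LatticeRep H) (k₀ : H) (ω : ℂ) (N j : ℕ)
    (hP : (isoProj ρH k₀ ω N j).trace ≠ 0) : isoChar ρH k₀ ω N j 1 = 1 := by
  unfold isoChar
  rw [map_one, Matrix.mul_one]
  exact div_self hP

/-- `isoChar_inv` (see the module docstring; verbatim from the Lines core §6). -/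
theorem isoChar_inv (ρH : LatticeRep H) (k₀ : H) (ω : ℂ) (N j : ℕ) (h : H) :
    isoChar ρH k₀ ω N j h⁻¹ = starRingEnd ℂ (isoChar ρH k₀ ω N j h) := by
  unfold isoChar
  rw [map_div₀, star_isoProj_trace]
  congr 1
  rw [latticeRep_map_inv, ← Complex.star_def, ← Matrix.trace_conjTranspose, Matrix.conjTranspose_mul,
    isoProj_conjTranspose, Matrix.trace_mul_comm]

/-- `isoChar_conj` (see the module docstring; verbatim from the Lines core §6). -/
theorem isoChar_conj (ρH : LatticeRep H) {k₀ : H} (hc : k₀ ∈ Subgroup.center H) (ω : ℂ) (N j : ℕ)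
    (g h : H) : isoChar ρH k₀ ω N j (g * h * g⁻¹) = isoChar ρH k₀ ω N j h := by
  unfold isoChar
  congr 1
  rw [map_mul, map_mul, ← Matrix.mul_assoc, ← Matrix.mul_assoc, Matrix.trace_mul_comm,
    ← Matrix.mul_assoc, ← Matrix.mul_assoc, ← isoProj_comm ρH hc, Matrix.mul_assoc (isoProj _ _ _ _ _),
    ← map_mul, inv_mul_cancel, map_one, Matrix.mul_one]

/-- `continuous_isoChar` (see the module docstring; verbatim from the Lines core §6). -/
theorem continuous_isoChar (ρH : LatticeRep H) (k₀ : H) (ω : ℂ) (N j : ℕ) :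
    Continuous (isoChar ρH k₀ ω N j) :=
  ((continuous_const.mul ρH.continuous).matrix_trace).div_const _

/-- Gram matrices of `h ↦ tr(P_j ρH h)` are PSD: `tr(P ρ(x_a⁻¹ x_b)) = tr((A ρ x_a)ᴴ (A ρ x_b))`. -/
theorem posSemidef_isoTrace_gram (ρH : LatticeRep H) {k₀ : H} (hc : k₀ ∈ Subgroup.center H)
    (ω : ℂ) (N j : ℕ) {n : ℕ} (x : Fin n → H) :
    (Matrix.of fun a b : Fin n => (isoProj ρH k₀ ω N j * ρH.ρ ((x a)⁻¹ * x b)).trace).PosSemidef := by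
  set A := isoAmp ρH k₀ ω N j with hAdef
  set B : Matrix (Fin ρH.N × Fin ρH.N) (Fin n) ℂ := Matrix.of fun pq b => (A * ρH.ρ (x b)) pq.1 pq.2
    with hB
  have hentry : ∀ a b : Fin n, (isoProj ρH k₀ ω N j * ρH.ρ ((x a)⁻¹ * x b)).trace =
      ((A * ρH.ρ (x a))ᴴ * (A * ρH.ρ (x b))).trace := by
    intro a b
    have hcomm := isoProj_comm ρH hc ω N j (x a)⁻¹
    unfold isoProj at hcomm ⊢
    rw [← hAdef] at hcomm ⊢
    rw [map_mul, ← Matrix.mul_assoc, hcomm, Matrix.conjTranspose_mul, ← latticeRep_map_inv]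
    simp only [Matrix.mul_assoc]
  have hT : (Matrix.of fun a b : Fin n => (isoProj ρH k₀ ω N j * ρH.ρ ((x a)⁻¹ * x b)).trace) =
      Bᴴ * B := by
    ext a b
    rw [Matrix.of_apply, hentry]
    simp only [Matrix.trace, Matrix.diag_apply, Matrix.mul_apply, Matrix.conjTranspose_apply, hB,
      Matrix.of_apply, Fintype.sum_prod_type]
    rw [Finset.sum_comm]
  rw [hT]
  exact Matrix.posSemidef_conjTranspose_mul_self B

/-- `isoChar_gram` (see the module docstring; verbatim from the Lines core §6). -/
theorem isoChar_gram (ρH : LatticeRep H) {k₀ : H} (hc : k₀ ∈ Subgroup.center H) (ω : ℂ) (N j : ℕ)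
    {n : ℕ} (x : Fin n → H) :
    (Matrix.of fun a b : Fin n => isoChar ρH k₀ ω N j ((x a)⁻¹ * x b)).PosSemidef := by
  obtain ⟨htr, hnn⟩ := isoProj_trace_eq_re ρH k₀ ω N j
  set t : ℝ := (isoProj ρH k₀ ω N j).trace.re with ht
  have hcoef : (0 : ℂ) ≤ ((t⁻¹ : ℝ) : ℂ) := Complex.zero_le_real.2 (inv_nonneg.2 hnn)
  have heq : (Matrix.of fun a b : Fin n => isoChar ρH k₀ ω N j ((x a)⁻¹ * x b)) =
      ((t⁻¹ : ℝ) : ℂ) •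
        Matrix.of fun a b : Fin n => (isoProj ρH k₀ ω N j * ρH.ρ ((x a)⁻¹ * x b)).trace := by
    ext a b
    simp only [Matrix.of_apply, Matrix.smul_apply, smul_eq_mul, isoChar]
    rw [htr, div_eq_inv_mul, ← Complex.ofReal_inv]
  rw [heq]
  exact (posSemidef_isoTrace_gram ρH hc ω N j x).smul hcoef

/-- **The isotypic normalised character `u_j` is a twist character for `(k₀, ω^j)`** whenever `P_j ≠ 0`. -/
theorem isTwistChar_isoChar (ρH : LatticeRep H) {k₀ : H} (hc : k₀ ∈ Subgroup.center H) {N : ℕ}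
    (hN : orderOf k₀ = N) {ω : ℂ} (hωN : ω ^ N = 1) (hω0 : ω ≠ 0) (j : ℕ)
    (hP : (isoProj ρH k₀ ω N j).trace ≠ 0) :
    IsTwistChar k₀ (ω ^ j) (isoChar ρH k₀ ω N j) :=
  ⟨continuous_isoChar ρH k₀ ω N j, isoChar_one ρH k₀ ω N j hP, isoChar_inv ρH k₀ ω N j,
    isoChar_conj ρH hc ω N j, isoChar_twist ρH hc hN hωN hω0 j, fun _ x => isoChar_gram ρH hc ω N j x⟩

end Iso

section Monomial

open Literature.MathematicalPhysics.QuantumFieldTheory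

variable {H : Type} [Group H] [TopologicalSpace H]

/-- **The isotypic Schur monomial `Π_j u_j^{b_j}` is a twist character for `(k₀, ω)`** as soon as the exponents
avoid the empty isotypic components and `Σ_j j·b_j ≡ 1 (mod N)`. -/
theorem isTwistChar_isoMonomial (ρH : LatticeRep H) {k₀ : H} (hc : k₀ ∈ Subgroup.center H) {N : ℕ}
    (hN : orderOf k₀ = N) (hNpos : 0 < N) {ω : ℂ} (hω : IsPrimitiveRoot ω N) (b : ℕ → ℕ)
    (hb : ∀ j ∈ range N, b j ≠ 0 → (isoProj ρH k₀ ω N j).trace ≠ 0)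
    (hsum : (∑ j ∈ range N, j * b j) ≡ 1 [MOD N]) :
    IsTwistChar k₀ ω (∏ j ∈ range N, isoChar ρH k₀ ω N j ^ b j) := by
  have hω0 : ω ≠ 0 := hω.ne_zero hNpos.ne'
  have hωN : ω ^ N = 1 := hω.pow_eq_one
  have hfac : ∀ j ∈ range N, IsTwistChar k₀ ((ω ^ j) ^ b j) (isoChar ρH k₀ ω N j ^ b j) := by
    intro j hj
    by_cases hbj : b j = 0
    · rw [hbj, pow_zero, pow_zero]
      exact isTwistChar_one k₀
    · exact (isTwistChar_isoChar ρH hc hN hωN hω0 j (hb j hj hbj)).pow (b j)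
  have hprod := IsTwistChar.prod (range N) hfac
  have h1 : ω ^ (1 % N) = ω := by
    by_cases hN1 : N = 1
    · subst hN1
      rw [IsPrimitiveRoot.one_right_iff] at hω
      rw [hω, one_pow]
    · rw [Nat.one_mod_eq_one.2 hN1, pow_one]
  have hexp : ∏ j ∈ range N, (ω ^ j) ^ b j = ω := by
    simp_rw [← pow_mul]
    rw [Finset.prod_pow_eq_pow_sum, ← Nat.div_add_mod (∑ j ∈ range N, j * b j) N, pow_add, pow_mul,
      hωN, one_pow, one_mul]
    unfold Nat.ModEq at hsum
    rw [hsum, h1]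
  rwa [hexp] at hprod

end Monomial

end Summit.QuantumFields.YangMills.Cruxes.IRcof.EquipartitionSeam.SchurFejer

end
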